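import Summits.ABC.ABC.Theorems.TwistAmplificationSharpModerateLawDefs

/-!
# Crux `TwistAmplification.SharpModerateLaw` (stmt-ABC-1975): objects of the line `deep-moduli-cusp-dispersion`

Definitions (no stub proofs) of the registered skeleton `Cruxes/SharpModerateLaw/Lines/deep_moduli_cusp_dispersion.lean`
(planner gen 2, v2.1; lead `prover-line-stmt-ABC-1975-2`), verbatim, over the tower-freeness predicate `TF` of the sister
line (`…SharpModerateLawDefs`, §B — literally the same proposition):

* the conductor proxy `Nstar (c₄, c₆) = ∏_{p ∣ Δ} (p² if p ∣ c₄ else p)` over ALL primes of `Δ = (c₄³ − c₆²)/1728`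
  (including `2` and `3`; on a minimal model `Nstar ≤ conductorNorm`, landed as `DeepModuli.nstar_dvd_conductorNorm`);
* the DYADIC cusp set `cuspSetD X Y` (`c₄c₆ ≠ 0`, cusp excised `c₄³ ≠ c₆²`, `1728 ∣ c₄³ − c₆²`, tower-free,
  `M⁺ = max(|c₄|³, |c₄³−c₆²|/1728) ∈ (Y/2, Y]`, `Nstar ≤ X`) and the transfer target C⁺′ = `CuspLawD`
  (`#cuspSetD(X,Y) ≤ C X^ε (X·Y^{-1/6} + 1)` on the cone `X³ ≤ 8Y ≤ 8X^σ`, every `σ > 6`);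
* the simple radical `simpleRad` (`∏_{p ∥ c₄³−c₆²} p`), the three regimes `HallRegime` (`|c₄³−c₆²| ≤ 1728√Y`),
  `ResolvedRegime` (thick tube, `simpleRad ≥ Y^{1/6}`), `DeepRegime` (thick tube, `simpleRad < Y^{1/6}`), and the
  restricted law `LawOn P`;
* the complete cusp sums `cuspSum p n h₁ h₂ = Σ_{t ∈ (ℤ/pⁿ)ˣ} e((h₁t² + h₂t³)/pⁿ)` and their stationary-phase bound
  `CuspSumBound` (landed as `DeepModuli.stub_cuspStationaryPhase`);
* the five stub statements `CuspTransfer`, `CuspStationaryPhase`, `ResolvedRegimeLaw`, `DeepRegimeLaw`, `HallRegimeLaw`.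

The reduction `ResolvedRegimeLaw → DeepRegimeLaw → HallRegimeLaw → SharpModerateLaw` (two stubs discharged) and the
calibration `LawOn DeepRegime → MazurKaneLaw` live in `…DeepModuliReduction.lean` / `…DeepModuliCalibration.lean`.
-/

set_option linter.dupNamespace false  -- `Summit.ABC.ABC.…`: summit = sub-problem name (D-0017 layout)

noncomputable section

namespace Summit.ABC.ABC.Theorems.SharpModerateLaw.DeepModuli

open scoped BigOperators

/-! ## A. The objects of C⁺′ -/

/-- Conductor proxy `N*(c₄,c₆) = ∏_{p ∣ Δ} (p² if p ∣ c₄ else p)`, `Δ = (c₄³ − c₆²)/1728`, over ALL primes of `|Δ|`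
(on a minimal model `N* ≤ conductorNorm`: `p ∣ Δ`, `p ∤ c₄` multiplicative `f_p = 1`; `p ∣ Δ`, `p ∣ c₄` additive `f_p ≥ 2`). -/
def Nstar (x : ℤ × ℤ) : ℕ :=
  ∏ p ∈ ((x.1 ^ 3 - x.2 ^ 2) / 1728).natAbs.primeFactors, (if ((p : ℕ) : ℤ) ∣ x.1 then p ^ 2 else p)

/-- The DYADIC cusp set at scales `(X, Y)`: pairs `(u,v) = (c₄,c₆)` with `uv ≠ 0`, `u³ ≠ v²`, `1728 ∣ u³ − v²`,
tower-free (`TF` of `…SharpModerateLawDefs`), `M⁺ := max(|u|³, |u³−v²|/1728) ∈ (Y/2, Y]` and `N* ≤ X`. -/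
def cuspSetD (X Y : ℝ) : Set (ℤ × ℤ) :=
  {x | x.1 ≠ 0 ∧ x.2 ≠ 0 ∧ x.1 ^ 3 ≠ x.2 ^ 2 ∧ (1728 : ℤ) ∣ x.1 ^ 3 - x.2 ^ 2 ∧ TF x ∧
    ((|x.1| ^ 3 : ℤ) : ℝ) ≤ Y ∧ ((|x.1 ^ 3 - x.2 ^ 2| : ℤ) : ℝ) ≤ 1728 * Y ∧
    Y < 2 * max (((|x.1| ^ 3 : ℤ) : ℝ)) (((|x.1 ^ 3 - x.2 ^ 2| : ℤ) : ℝ) / 1728) ∧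
    (Nstar x : ℝ) ≤ X}

/-- **C⁺′ = `CuspLawD`**, the line's transfer target: `#cuspSetD(X,Y) ≤ C_{σ,ε} X^ε (X·Y^{-1/6} + 1)` for
`X, Y ≥ 1`, `X³ ≤ 8Y`, `Y ≤ X^σ`, every `σ > 6`. (Implies the crux: `DeepModuli.stub_cuspTransfer`.) -/
def CuspLawD : Prop :=
  ∀ σ : ℝ, 6 < σ → ∀ ε : ℝ, 0 < ε → ∃ C : ℝ, ∀ X Y : ℝ, 1 ≤ X → 1 ≤ Y → X ^ 3 ≤ 8 * Y → Y ≤ X ^ σ →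
    (Set.ncard (cuspSetD X Y) : ℝ) ≤ C * X ^ ε * (X * Y ^ (-(1 / 6 : ℝ)) + 1)

/-- The SIMPLE RADICAL `r'(u,v) = ∏_{p ∥ u³ − v²} p` (primes dividing `u³ − v²` exactly once; automatically `p ≥ 5`,
`p ∤ u`); in the crux range `r' ≤ N* ≤ X ≤ 2Y^{1/3}`. -/
def simpleRad (x : ℤ × ℤ) : ℕ :=
  ∏ p ∈ (x.1 ^ 3 - x.2 ^ 2).natAbs.primeFactors.filter (fun p : ℕ => ¬ (((p : ℕ) : ℤ) ^ 2 ∣ x.1 ^ 3 - x.2 ^ 2)), p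

/-! ## B. The three regimes and the restricted law -/

/-- HALL regime (archimedean corner): `|u³ − v²| ≤ 1728·Y^{1/2}`, i.e. `|Δ| ≤ Y^{1/2}`. -/
def HallRegime (Y : ℝ) (x : ℤ × ℤ) : Prop :=
  ((|x.1 ^ 3 - x.2 ^ 2| : ℤ) : ℝ) ≤ 1728 * Y ^ (1 / 2 : ℝ)

/-- RESOLVED regime: thick tube and `r' ≥ Y^{1/6}` (every deep-modulus class expects `≳ 1` point). -/
def ResolvedRegime (Y : ℝ) (x : ℤ × ℤ) : Prop :=
  ¬ (((|x.1 ^ 3 - x.2 ^ 2| : ℤ) : ℝ) ≤ 1728 * Y ^ (1 / 2 : ℝ)) ∧ Y ^ (1 / 6 : ℝ) ≤ (simpleRad x : ℝ)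

/-- DEEP regime: thick tube and `r' < Y^{1/6}` (below resolution; only the average over the deep moduli can pay). -/
def DeepRegime (Y : ℝ) (x : ℤ × ℤ) : Prop :=
  ¬ (((|x.1 ^ 3 - x.2 ^ 2| : ℤ) : ℝ) ≤ 1728 * Y ^ (1 / 2 : ℝ)) ∧ (simpleRad x : ℝ) < Y ^ (1 / 6 : ℝ)

/-- The law C⁺′ restricted to the pairs satisfying `P` (same cone, same right side). -/
def LawOn (P : ℝ → ℤ × ℤ → Prop) : Prop :=
  ∀ σ : ℝ, 6 < σ → ∀ ε : ℝ, 0 < ε → ∃ C : ℝ, ∀ X Y : ℝ, 1 ≤ X → 1 ≤ Y → X ^ 3 ≤ 8 * Y → Y ≤ X ^ σ →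
    (Set.ncard {x : ℤ × ℤ | x ∈ cuspSetD X Y ∧ P Y x} : ℝ) ≤ C * X ^ ε * (X * Y ^ (-(1 / 6 : ℝ)) + 1)

/-! ## C. The complete cusp sums -/

/-- `S(h₁,h₂;pⁿ) = Σ_{t ∈ (ℤ/pⁿ)ˣ} e((h₁t² + h₂t³)/pⁿ)`: the complete exponential sum along the parametrised cusp `(t², t³)`
to the prime-power modulus `pⁿ` (every Poisson/completion step modulo a powerful deep modulus factors into these by CRT). -/
def cuspSum (p n : ℕ) (h₁ h₂ : ℤ) : ℂ :=
  ∑ t ∈ (Finset.range (p ^ n)).filter (fun t : ℕ => Nat.Coprime t p),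
    Complex.exp (2 * (Real.pi : ℂ) * Complex.I * ((h₁ : ℂ) * (t : ℂ) ^ 2 + (h₂ : ℂ) * (t : ℂ) ^ 3) / (p : ℂ) ^ n)

/-- **Stationary phase for the cusp sums**: for `p ≥ 5` prime, `n ≥ 2` and `(h₁,h₂)` not both divisible by `p`,
`|S(h₁,h₂;pⁿ)| ≤ 2·p^{n/2}` (landed: `DeepModuli.stub_cuspStationaryPhase`; truth is `0` or exactly `p^{n/2}`). -/
def CuspSumBound : Prop :=
  ∀ p n : ℕ, p.Prime → 5 ≤ p → 2 ≤ n → ∀ h₁ h₂ : ℤ, ¬ ((p : ℤ) ∣ h₁ ∧ (p : ℤ) ∣ h₂) →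
    ‖cuspSum p n h₁ h₂‖ ≤ 2 * (p : ℝ) ^ ((n : ℝ) / 2)

/-! ## D. The five stub statements of the line -/

/-- STUB 1 (transfer): C⁺′ implies the crux. Landed (`DeepModuli.stub_cuspTransfer`, p96579). -/
def CuspTransfer : Prop :=
  CuspLawD → Summit.ABC.ABC.Theses.TwistAmplification.SharpModerateLaw

/-- STUB 2: the stationary-phase bound. Landed (`DeepModuli.stub_cuspStationaryPhase`, p97373). -/
def CuspStationaryPhase : Prop := CuspSumBound

/-- STUB 3 (open): stationary phase ⇒ the law on the resolved regime. -/
def ResolvedRegimeLaw : Prop := CuspSumBound → LawOn ResolvedRegime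

/-- STUB 4 (open, hardest): stationary phase ⇒ the law on the deep regime. -/
def DeepRegimeLaw : Prop := CuspSumBound → LawOn DeepRegime

/-- STUB 5 (open): the law on the Hall regime. -/
def HallRegimeLaw : Prop := LawOn HallRegime

/-! ## E. Sanity: C⁺′ is the restricted law for the trivial predicate -/

/-- `CuspLawD ↔ LawOn (fun _ _ => True)` (registered sub-goal `cuspLawD_iff_lawOn_true` of stmt-ABC-1975; used by the
reduction file to pass from the three regime laws to C⁺′). -/
theorem cuspLawD_iff_lawOn_true : CuspLawD ↔ LawOn (fun _ _ => True) := by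
  have hset : ∀ X Y : ℝ, {x : ℤ × ℤ | x ∈ cuspSetD X Y ∧ True} = cuspSetD X Y := fun X Y => by
    ext x; simp
  unfold CuspLawD LawOn
  simp only [hset]

end Summit.ABC.ABC.Theorems.SharpModerateLaw.DeepModuli

end
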